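import Mathlib
import HarnessLib

/-!
# A module-finite torsion-free algebra of generic rank one over an integrally closed domain is the base;
# a finite flat algebra split into as many non-zero corners as its generic rank is a power of the base
(Atiyah–Macdonald, *Introduction to Commutative Algebra*, Ch. 5, Prop. 5.1 and the notion of an integrally closed domain;
Tate, *Finite flat group schemes* (in Cornell–Silverman–Stevens 1997), §3.7, where this is the algebra behind «a finite flat
local algebra of generic rank `1` over a henselian valuation ring is the base» and the étale count of closures)

Topic `RingTheory/IntegralClosure`; namespace `Literature.RingTheory.IntegralClosure`.  THEOREMS ONLY (no definition, no instance,
no notation, no named fact, no `sorry`); Mathlib-only.  Cell `pub/hodgecm-mathlib` (D-0151), FLOOR 0, programme F0P5a (crux item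
stmt-HodgeConjecture-24832; PLAN v4 §4 ∕ MOD-ROAD-P″ §4 row G4 «finite flat closure dichotomy», its ALGEBRA sub-lemma — generic,
road-independent commutative algebra; changes no count).

SETTING.  `R` an integrally closed domain with fraction field `K` (`[IsFractionRing R K]`; every valuation ring qualifies, Mathlib
instance), `S` a commutative `R`-algebra which is module-finite (`[Module.Finite R S]`); its GENERIC FIBRE is the `K`-algebra
`K ⊗[R] S` and its GENERIC RANK is `Module.finrank K (K ⊗[R] S)`.  «Torsion-free» enters only through the injectivity of
`S → K ⊗[R] S`, `s ↦ 1 ⊗ s` (`Algebra.TensorProduct.includeRight`), which holds for `S` flat over `R`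
(★ Mathlib `Algebra.TensorProduct.includeRight_injective`).

* §1 **`algebraMap_bijective_of_finrank_baseChange_eq_one_of_injective`** — if `S → K ⊗[R] S` is injective and the generic rank is
  `1`, then `algebraMap R S` is bijective (`S = R`).  Proof: `K → K ⊗[R] S` is bijective (free of rank one,
  ★ `Module.Free.bijective_algebraMap_of_finrank_eq_one`), so `S` embeds `R`-algebraically into `K`; `S` is integral over `R`
  (module-finite), hence its image lies in the integral closure of `R` in `K`, which is `R`.  No «local», «henselian» or «valuation»
  hypothesis is needed.  Flat dress: **`algebraMap_bijective_of_finrank_baseChange_eq_one`** (`[Module.Flat R S]`).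
* §2 corners of a complete family of orthogonal idempotents `e : ι → S` (Mathlib `CompleteOrthogonalIdempotents`; the currency of
  ★ `Literature/RingTheory/Henselian/FiniteAlgebraProductOfLocalizations`, which produces such a family indexed by the maximal ideals
  of a finite algebra over a henselian local ring): the corner `S ⧸ (1 - e i)` is a module retract of `S`
  (`quotient_span_one_sub_retract`), hence finite and flat when `S` is; it is non-zero iff `e i ≠ 0`
  (`nontrivial_quotient_span_one_sub`); the generic fibre splits accordingly
  (`finrank_baseChange_eq_sum` : `finrank_K (K ⊗ S) = Σ_i finrank_K (K ⊗ S ⧸ (1 - e i))`).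
* §3 **`card_le_finrank_baseChange`** — a finite flat `S` with a complete family of `n` NON-ZERO orthogonal idempotents has generic
  rank `≥ n`; **`algebraMap_quotient_bijective_of_finrank_baseChange_eq_card`** — if the generic rank EQUALS `n`, every corner is
  the base (`R → S ⧸ (1 - e i)` bijective), i.e. **`bijective_pi_of_finrank_baseChange_eq_card`**: `S → Π_i R`-shaped,
  `S ≅ Rⁿ` as an `R`-algebra (`nonempty_algEquiv_pi_of_finrank_baseChange_eq_card`).  This is the algebra of the ÉTALE half of
  the closure dichotomy: a finite flat algebra over a (henselian) valuation ring whose special fibre meets `n = generic rank`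
  distinct local factors is `Rⁿ`.

HC_CM is proved only modulo the 7 printed citations until rung 0 closes; this file is generic commutative algebra and changes no count.

## References
* [AtiyahMacdonald1969] M. F. Atiyah, I. G. Macdonald, *Introduction to Commutative Algebra* (1969), Ch. 5: Prop. 5.1 (module-finite
  ⇒ integral) and §«integrally closed domains» (p. 60–63).
* [Tate1997FiniteFlatGroupSchemes] J. Tate, *Finite flat group schemes*, in: Modular Forms and Fermat's Last Theorem (1997), §3.7
  (connected and étale parts over a henselian base; the rank bookkeeping used here).
-/

set_option autoImplicit false

noncomputable section

open TensorProduct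

namespace Literature.RingTheory.IntegralClosure

universe u v w

variable {R : Type u} [CommRing R] (K : Type v) [Field K] [Algebra R K]
variable {S : Type w} [CommRing S] [Algebra R S]

/-! ## §1 Generic rank one -/

/-- **Generic rank one rigidity.**  Let `R` be an integrally closed domain with fraction field `K` and `S` a module-finite
commutative `R`-algebra such that `S → K ⊗[R] S` is injective (e.g. `S` flat over `R`).  If the generic fibre `K ⊗[R] S` has
`K`-dimension `1`, then `R → S` is bijective.  (The image of `S` in `K ⊗[R] S = K` is integral over `R`, hence inside `R`.)
[cite: AtiyahMacdonald1969, Ch. 5, Prop. 5.1] -/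
theorem algebraMap_bijective_of_finrank_baseChange_eq_one_of_injective [IsDomain R] [IsIntegrallyClosed R]
    [IsFractionRing R K] [Module.Finite R S]
    (hinj : Function.Injective (Algebra.TensorProduct.includeRight : S →ₐ[R] K ⊗[R] S))
    (h1 : Module.finrank K (K ⊗[R] S) = 1) :
    Function.Bijective (algebraMap R S) := by
  -- `K → K ⊗ S` is bijective
  have hK : Function.Bijective (algebraMap K (K ⊗[R] S)) :=
    Module.Free.bijective_algebraMap_of_finrank_eq_one h1
  let eK : K ≃+* K ⊗[R] S := RingEquiv.ofBijective (algebraMap K (K ⊗[R] S)) hK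
  have heK : ∀ k, eK k = algebraMap K (K ⊗[R] S) k := fun _ => rfl
  -- the `R`-algebra map `ψ : S → K`, `s ↦ eK⁻¹ (1 ⊗ s)`
  have hcomm : ∀ r : R, (Algebra.TensorProduct.includeRight : S →ₐ[R] K ⊗[R] S) (algebraMap R S r) =
      algebraMap K (K ⊗[R] S) (algebraMap R K r) := fun r => by
    rw [AlgHom.commutes, IsScalarTower.algebraMap_apply R K (K ⊗[R] S)]
  let ψ : S →ₐ[R] K :=
    { toRingHom := eK.symm.toRingHom.comp (Algebra.TensorProduct.includeRight : S →ₐ[R] K ⊗[R] S).toRingHom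
      commutes' := fun r => by
        change eK.symm ((Algebra.TensorProduct.includeRight : S →ₐ[R] K ⊗[R] S) (algebraMap R S r)) = algebraMap R K r
        rw [hcomm, ← heK, RingEquiv.symm_apply_apply] }
  have hψ : ∀ s, algebraMap K (K ⊗[R] S) (ψ s) =
      (Algebra.TensorProduct.includeRight : S →ₐ[R] K ⊗[R] S) s := fun s => by
    change eK (eK.symm _) = _
    rw [RingEquiv.apply_symm_apply]
    rfl
  refine ⟨fun r r' hrr' => ?_, fun s => ?_⟩
  · -- injectivity: `R → K → K ⊗ S` is injective
    have h := congrArg (Algebra.TensorProduct.includeRight : S →ₐ[R] K ⊗[R] S) hrr'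
    rw [hcomm, hcomm] at h
    exact IsFractionRing.injective R K (hK.1 h)
  · -- surjectivity: `ψ s ∈ K` is integral over `R`, hence comes from `R`
    have hint : IsIntegral R (ψ s) := (Algebra.IsIntegral.isIntegral (R := R) s).map ψ
    obtain ⟨r, hr⟩ := IsIntegrallyClosed.algebraMap_eq_of_integral hint
    refine ⟨r, hinj ?_⟩
    rw [hcomm, hr, hψ]

/-- **Generic rank one rigidity, flat form.**  A module-finite FLAT commutative algebra `S` over an integrally closed domain `R`
whose generic fibre `K ⊗[R] S` is `1`-dimensional is `R` itself: `R → S` is bijective.  In particular a finite flat local algebra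
of generic rank `1` over a (henselian) valuation ring is the base. [cite: AtiyahMacdonald1969, Ch. 5, Prop. 5.1]
[cite: Tate1997FiniteFlatGroupSchemes, §3.7] -/
theorem algebraMap_bijective_of_finrank_baseChange_eq_one [IsDomain R] [IsIntegrallyClosed R] [IsFractionRing R K]
    [Module.Finite R S] [Module.Flat R S] (h1 : Module.finrank K (K ⊗[R] S) = 1) :
    Function.Bijective (algebraMap R S) :=
  algebraMap_bijective_of_finrank_baseChange_eq_one_of_injective K
    (Algebra.TensorProduct.includeRight_injective (IsFractionRing.injective R K)) h1

/-! ## §2 Corners of a complete family of orthogonal idempotents -/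

section Corners

variable {ι : Type*} [Fintype ι] {e : ι → S}

omit [Algebra R S] in
/-- the corner `S ⧸ (1 - e)` of an idempotent `e` is non-zero iff `e ≠ 0`. [cite: Tate1997FiniteFlatGroupSchemes, §3.7] -/
theorem nontrivial_quotient_span_one_sub {e₀ : S} (he : IsIdempotentElem e₀) (hne : e₀ ≠ 0) :
    Nontrivial (S ⧸ Ideal.span ({1 - e₀} : Set S)) := by
  refine Ideal.Quotient.nontrivial_iff.2 (Ideal.span_singleton_ne_top fun hu => hne ?_)
  obtain ⟨u, hu⟩ := hu
  -- `e₀ = e₀ (1 - e₀) u⁻¹ = 0`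
  calc e₀ = e₀ * ((1 - e₀) * ↑u⁻¹) := by rw [← hu, Units.mul_inv, mul_one]
    _ = 0 := by rw [← mul_assoc, he.mul_one_sub_self, zero_mul]

/-- the `S`-linear section `S ⧸ (1 - e) → S`, `x̄ ↦ e x`, of the corner projection (well defined since `e (1 - e) = 0`).
[cite: Tate1997FiniteFlatGroupSchemes, §3.7] -/
theorem quotient_span_one_sub_retract {e₀ : S} (he : IsIdempotentElem e₀) :
    ∃ σ : (S ⧸ Ideal.span ({1 - e₀} : Set S)) →ₗ[S] S,
      (∀ s : S, σ (Ideal.Quotient.mk _ s) = e₀ * s) ∧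
        (Submodule.mkQ (Ideal.span ({1 - e₀} : Set S))).comp σ = LinearMap.id := by
  have hle : Ideal.span ({1 - e₀} : Set S) ≤ LinearMap.ker (LinearMap.mulLeft S e₀) := by
    rw [Ideal.span_le]
    rintro x rfl
    rw [SetLike.mem_coe, LinearMap.mem_ker, LinearMap.mulLeft_apply, he.mul_one_sub_self]
  refine ⟨Submodule.liftQ _ (LinearMap.mulLeft S e₀) hle, fun s => rfl, ?_⟩
  refine LinearMap.ext fun x => ?_
  obtain ⟨s, rfl⟩ := Ideal.Quotient.mk_surjective x
  change Ideal.Quotient.mk _ (e₀ * s) = Ideal.Quotient.mk _ s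
  rw [Ideal.Quotient.eq, Ideal.mem_span_singleton]
  exact ⟨-s, by ring⟩

/-- a corner of a module-finite algebra is module-finite. [cite: AtiyahMacdonald1969, Ch. 5, Prop. 5.1] -/
theorem finite_quotient_span_one_sub [Module.Finite R S] (e₀ : S) :
    Module.Finite R (S ⧸ Ideal.span ({1 - e₀} : Set S)) :=
  Module.Finite.of_surjective (Ideal.Quotient.mkₐ R (Ideal.span ({1 - e₀} : Set S))).toLinearMap
    (Ideal.Quotient.mkₐ_surjective R _)

/-- a corner of a flat algebra is flat (it is a module retract). [cite: Tate1997FiniteFlatGroupSchemes, §3.7] -/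
theorem flat_quotient_span_one_sub [Module.Flat R S] {e₀ : S} (he : IsIdempotentElem e₀) :
    Module.Flat R (S ⧸ Ideal.span ({1 - e₀} : Set S)) := by
  obtain ⟨σ, -, hσ⟩ := quotient_span_one_sub_retract he
  refine Module.Flat.of_retract (σ.restrictScalars R) ((Submodule.mkQ (Ideal.span ({1 - e₀} : Set S))).restrictScalars R) ?_
  refine LinearMap.ext fun x => ?_
  exact LinearMap.congr_fun hσ x

/-- the product decomposition `S ≃ₐ[R] Π_i S ⧸ (1 - e i)` of a complete family of orthogonal idempotents
(Mathlib `CompleteOrthogonalIdempotents.bijective_pi`, as an `R`-algebra equivalence). [cite: Tate1997FiniteFlatGroupSchemes, §3.7] -/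
theorem exists_algEquiv_pi_quotient [DecidableEq ι] (he : CompleteOrthogonalIdempotents e) :
    ∃ f : S ≃ₐ[R] Π i, S ⧸ Ideal.span ({1 - e i} : Set S), ∀ s i, f s i = Ideal.Quotient.mk _ s := by
  refine ⟨AlgEquiv.ofBijective (AlgHom.pi fun i => Ideal.Quotient.mkₐ R (Ideal.span ({1 - e i} : Set S)))
    he.bijective_pi, fun s i => rfl⟩

/-- **the generic fibre splits along the corners**: `finrank_K (K ⊗ S) = Σ_i finrank_K (K ⊗ (S ⧸ (1 - e i)))` for a module-finite
`S`. [cite: Tate1997FiniteFlatGroupSchemes, §3.7] -/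
theorem finrank_baseChange_eq_sum [DecidableEq ι] [Module.Finite R S] (he : CompleteOrthogonalIdempotents e) :
    Module.finrank K (K ⊗[R] S) = ∑ i, Module.finrank K (K ⊗[R] (S ⧸ Ideal.span ({1 - e i} : Set S))) := by
  obtain ⟨f, -⟩ := exists_algEquiv_pi_quotient (R := R) he
  haveI : ∀ i, Module.Finite R (S ⧸ Ideal.span ({1 - e i} : Set S)) := fun i => finite_quotient_span_one_sub (R := R) (e i)
  let g : K ⊗[R] S ≃ₐ[K] Π i, K ⊗[R] (S ⧸ Ideal.span ({1 - e i} : Set S)) :=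
    (Algebra.TensorProduct.congr (AlgEquiv.refl : K ≃ₐ[K] K) f).trans
      (Algebra.TensorProduct.piRight R K K fun i => S ⧸ Ideal.span ({1 - e i} : Set S))
  rw [g.toLinearEquiv.finrank_eq, Module.finrank_pi_fintype]

end Corners

/-! ## §3 The count: `n` non-zero corners force generic rank `≥ n`, with equality iff every corner is the base -/

section Count

variable {ι : Type*} [Fintype ι] {e : ι → S}

/-- a non-zero finite flat corner has generic rank `≥ 1`. [cite: Tate1997FiniteFlatGroupSchemes, §3.7] -/
theorem finrank_baseChange_quotient_pos [IsDomain R] [IsFractionRing R K] [Module.Finite R S] [Module.Flat R S]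
    (he : CompleteOrthogonalIdempotents e) (hne : ∀ i, e i ≠ 0) (i : ι) :
    0 < Module.finrank K (K ⊗[R] (S ⧸ Ideal.span ({1 - e i} : Set S))) := by
  haveI := nontrivial_quotient_span_one_sub (he.idem i) (hne i)
  haveI := finite_quotient_span_one_sub (R := R) (e i)
  haveI := flat_quotient_span_one_sub (R := R) (he.idem i)
  haveI : Nontrivial (K ⊗[R] (S ⧸ Ideal.span ({1 - e i} : Set S))) :=
    (Algebra.TensorProduct.includeRight_injective (R := R) (A := K) (B := S ⧸ Ideal.span ({1 - e i} : Set S))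
      (IsFractionRing.injective R K)).nontrivial
  exact Module.finrank_pos

/-- **`n` non-zero corners ⇒ generic rank `≥ n`.**  For a finite flat `S` over a domain `R` with a complete family of non-zero
orthogonal idempotents indexed by `ι`: `|ι| ≤ finrank_K (K ⊗[R] S)`. [cite: Tate1997FiniteFlatGroupSchemes, §3.7] -/
theorem card_le_finrank_baseChange [DecidableEq ι] [IsDomain R] [IsFractionRing R K] [Module.Finite R S]
    [Module.Flat R S] (he : CompleteOrthogonalIdempotents e) (hne : ∀ i, e i ≠ 0) :
    Fintype.card ι ≤ Module.finrank K (K ⊗[R] S) := by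
  have hcard : ∑ _i : ι, (1 : ℕ) = Fintype.card ι := by simp
  rw [finrank_baseChange_eq_sum K he, ← hcard]
  exact Finset.sum_le_sum fun i _ => finrank_baseChange_quotient_pos K he hne i

/-- with generic rank EQUAL to the number of non-zero corners, every corner has generic rank exactly `1`.
[cite: Tate1997FiniteFlatGroupSchemes, §3.7] -/
theorem finrank_baseChange_quotient_eq_one_of_finrank_baseChange_eq_card [DecidableEq ι] [IsDomain R]
    [IsFractionRing R K] [Module.Finite R S] [Module.Flat R S] (he : CompleteOrthogonalIdempotents e) (hne : ∀ i, e i ≠ 0)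
    (h : Module.finrank K (K ⊗[R] S) = Fintype.card ι) (i : ι) :
    Module.finrank K (K ⊗[R] (S ⧸ Ideal.span ({1 - e i} : Set S))) = 1 := by
  have hle : ∀ j ∈ (Finset.univ : Finset ι),
      1 ≤ Module.finrank K (K ⊗[R] (S ⧸ Ideal.span ({1 - e j} : Set S))) :=
    fun j _ => finrank_baseChange_quotient_pos K he hne j
  have hcard : ∑ _i : ι, (1 : ℕ) = Fintype.card ι := by simp
  have hsum : ∑ _j : ι, (1 : ℕ) = ∑ j, Module.finrank K (K ⊗[R] (S ⧸ Ideal.span ({1 - e j} : Set S))) := by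
    rw [← finrank_baseChange_eq_sum K he, h, hcard]
  exact (((Finset.sum_eq_sum_iff_of_le hle).1 hsum) i (Finset.mem_univ i)).symm

/-- **THE COUNT.**  Let `R` be an integrally closed domain with fraction field `K`, `S` a module-finite flat commutative
`R`-algebra and `e : ι → S` a complete family of NON-ZERO orthogonal idempotents with `finrank_K (K ⊗[R] S) = |ι|`.  Then every
corner is the base: `R → S ⧸ (1 - e i)` is bijective.  (Étale half of the closure dichotomy: a finite flat algebra over a henselian
valuation ring whose special fibre meets `n = generic rank` local factors is `Rⁿ`.) [cite: Tate1997FiniteFlatGroupSchemes, §3.7]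
[cite: AtiyahMacdonald1969, Ch. 5, Prop. 5.1] -/
theorem algebraMap_quotient_bijective_of_finrank_baseChange_eq_card [DecidableEq ι] [IsDomain R] [IsIntegrallyClosed R]
    [IsFractionRing R K] [Module.Finite R S] [Module.Flat R S] (he : CompleteOrthogonalIdempotents e) (hne : ∀ i, e i ≠ 0)
    (h : Module.finrank K (K ⊗[R] S) = Fintype.card ι) (i : ι) :
    Function.Bijective (algebraMap R (S ⧸ Ideal.span ({1 - e i} : Set S))) := by
  haveI := finite_quotient_span_one_sub (R := R) (e i)
  haveI := flat_quotient_span_one_sub (R := R) (he.idem i)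
  exact algebraMap_bijective_of_finrank_baseChange_eq_one K
    (finrank_baseChange_quotient_eq_one_of_finrank_baseChange_eq_card K he hne h i)

/-- … assembled: `S → Π_i R`-shape — the map `S → Π_i S ⧸ (1 - e i)` is bijective and each `R → S ⧸ (1 - e i)` is bijective.
[cite: Tate1997FiniteFlatGroupSchemes, §3.7] -/
theorem bijective_pi_of_finrank_baseChange_eq_card [DecidableEq ι] [IsDomain R] [IsIntegrallyClosed R] [IsFractionRing R K]
    [Module.Finite R S] [Module.Flat R S] (he : CompleteOrthogonalIdempotents e) (hne : ∀ i, e i ≠ 0)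
    (h : Module.finrank K (K ⊗[R] S) = Fintype.card ι) :
    Function.Bijective (RingHom.pi fun i => Ideal.Quotient.mk (Ideal.span ({1 - e i} : Set S))) ∧
      ∀ i, Function.Bijective (algebraMap R (S ⧸ Ideal.span ({1 - e i} : Set S))) :=
  ⟨he.bijective_pi, algebraMap_quotient_bijective_of_finrank_baseChange_eq_card K he hne h⟩

/-- **`S ≅ Rⁿ`.**  Under the hypotheses of the count, `S` is `R`-algebra isomorphic to `Π_i R` (finite étale and split).
[cite: Tate1997FiniteFlatGroupSchemes, §3.7] -/
theorem nonempty_algEquiv_pi_of_finrank_baseChange_eq_card [DecidableEq ι] [IsDomain R] [IsIntegrallyClosed R] [IsFractionRing R K]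
    [Module.Finite R S] [Module.Flat R S] (he : CompleteOrthogonalIdempotents e) (hne : ∀ i, e i ≠ 0)
    (h : Module.finrank K (K ⊗[R] S) = Fintype.card ι) :
    Nonempty (S ≃ₐ[R] (ι → R)) := by
  obtain ⟨f, -⟩ := exists_algEquiv_pi_quotient (R := R) he
  have hb := algebraMap_quotient_bijective_of_finrank_baseChange_eq_card K he hne h
  -- each corner is `R`
  let g : ∀ i, R ≃ₐ[R] S ⧸ Ideal.span ({1 - e i} : Set S) := fun i =>
    AlgEquiv.ofBijective (Algebra.ofId R _) (hb i)
  exact ⟨f.trans (AlgEquiv.piCongrRight fun i => (g i).symm)⟩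

end Count

/-! ## §4 `R`-points = `K`-points (ED. 2, append-only)

For a module-finite commutative algebra `S` over an integrally closed domain `R` with fraction field `K`: every `R`-algebra map
`S → K` lands in `R` (its values are integral over `R`), so the `R`-valued points `S →ₐ[R] R` are the same as the `K`-valued
points of `S`, which by the base-change adjunction (Mathlib `Algebra.TensorProduct.liftEquivRight`) are the `K`-points
`K ⊗[R] S →ₐ[K] K` of the generic fibre.  No flatness is needed here. -/

section Points

/-- every `K`-valued `R`-algebra point of a module-finite `S` takes values in `R`. [cite: AtiyahMacdonald1969, Ch. 5, Prop. 5.1] -/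
theorem exists_algebraMap_eq_algHom_apply [IsDomain R] [IsIntegrallyClosed R] [IsFractionRing R K] [Module.Finite R S]
    (f : S →ₐ[R] K) (s : S) : ∃ r : R, algebraMap R K r = f s :=
  IsIntegrallyClosed.algebraMap_eq_of_integral ((Algebra.IsIntegral.isIntegral (R := R) s).map f)

/-- **`K`-valued points descend to `R`-valued points, uniquely**: every `f : S →ₐ[R] K` is `R ↪ K` composed with a unique
`g : S →ₐ[R] R`. [cite: AtiyahMacdonald1969, Ch. 5, Prop. 5.1] -/
theorem existsUnique_algHom_ofId_comp_eq [IsDomain R] [IsIntegrallyClosed R] [IsFractionRing R K] [Module.Finite R S]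
    (f : S →ₐ[R] K) : ∃! g : S →ₐ[R] R, (Algebra.ofId R K).comp g = f := by
  have hinj : Function.Injective (Algebra.ofId R K) := IsFractionRing.injective R K
  have hmem : ∀ s, f s ∈ (Algebra.ofId R K).range := fun s => by
    obtain ⟨r, hr⟩ := exists_algebraMap_eq_algHom_apply K f s
    exact ⟨r, hr⟩
  refine ⟨(AlgEquiv.ofInjective (Algebra.ofId R K) hinj).symm.toAlgHom.comp (f.codRestrict (Algebra.ofId R K).range hmem),
    ?_, fun g hg => ?_⟩
  · ext s
    change Algebra.ofId R K ((AlgEquiv.ofInjective (Algebra.ofId R K) hinj).symm ⟨f s, hmem s⟩) = f s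
    have h := AlgEquiv.ofInjective_apply (Algebra.ofId R K) hinj
      ((AlgEquiv.ofInjective (Algebra.ofId R K) hinj).symm ⟨f s, hmem s⟩)
    rw [AlgEquiv.apply_symm_apply] at h
    exact h.symm
  · have hg' : (Algebra.ofId R K).comp g = f := hg
    ext s
    apply hinj
    change Algebra.ofId R K (g s) = Algebra.ofId R K ((AlgEquiv.ofInjective (Algebra.ofId R K) hinj).symm ⟨f s, hmem s⟩)
    have h := AlgEquiv.ofInjective_apply (Algebra.ofId R K) hinj
      ((AlgEquiv.ofInjective (Algebra.ofId R K) hinj).symm ⟨f s, hmem s⟩)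
    rw [AlgEquiv.apply_symm_apply] at h
    have hfs : Algebra.ofId R K (g s) = f s := AlgHom.congr_fun hg' s
    rw [hfs]
    exact h

/-- composition with `R ↪ K` is a bijection `(S →ₐ[R] R) → (S →ₐ[R] K)`. [cite: AtiyahMacdonald1969, Ch. 5, Prop. 5.1] -/
theorem bijective_ofId_comp [IsDomain R] [IsIntegrallyClosed R] [IsFractionRing R K] [Module.Finite R S] :
    Function.Bijective fun g : S →ₐ[R] R => (Algebra.ofId R K).comp g := by
  refine ⟨fun g g' h => ?_, fun f => ?_⟩
  · obtain ⟨g₀, -, huniq⟩ := existsUnique_algHom_ofId_comp_eq K ((Algebra.ofId R K).comp g)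
    exact (huniq g rfl).trans (huniq g' h.symm).symm
  · obtain ⟨g, hg, -⟩ := existsUnique_algHom_ofId_comp_eq K f
    exact ⟨g, hg⟩

/-- **`R`-points = `K`-points of the generic fibre.**  The map `(S →ₐ[R] R) → (K ⊗[R] S →ₐ[K] K)`,
`g ↦ lift (K → K) (R ↪ K ∘ g)` (Mathlib `Algebra.TensorProduct.liftEquivRight` after composing with `R ↪ K`), is a bijection for
`S` module-finite over the integrally closed domain `R`. [cite: AtiyahMacdonald1969, Ch. 5, Prop. 5.1]
[cite: Tate1997FiniteFlatGroupSchemes, §3.7] -/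
theorem bijective_liftEquivRight_ofId_comp [IsDomain R] [IsIntegrallyClosed R] [IsFractionRing R K] [Module.Finite R S] :
    Function.Bijective fun g : S →ₐ[R] R =>
      Algebra.TensorProduct.liftEquivRight R K S K ((Algebra.ofId R K).comp g) :=
  (Algebra.TensorProduct.liftEquivRight R K S K).bijective.comp (bijective_ofId_comp K)

/-- the evaluation formula of the `K`-point attached to `g : S →ₐ[R] R`: `k ⊗ s ↦ k · g(s)`. [cite: Tate1997FiniteFlatGroupSchemes, §3.7] -/
theorem liftEquivRight_ofId_comp_tmul [IsFractionRing R K] (g : S →ₐ[R] R) (k : K) (s : S) :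
    Algebra.TensorProduct.liftEquivRight R K S K ((Algebra.ofId R K).comp g) (k ⊗ₜ s) = k * algebraMap R K (g s) := by
  simp [Algebra.TensorProduct.liftEquivRight, Algebra.TensorProduct.lift_tmul, Algebra.ofId_apply]

end Points

end Literature.RingTheory.IntegralClosure

end
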